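import Summits.AtomisticToContinuum.FouriersLaw.Theses.OddSectorIrreversibility
import Summits.AtomisticToContinuum.FouriersLaw.Theses.VanishingNoiseTransfer

/-!
# Crux `BoundedResponseConverges` (stmt-AtomisticToContinuum-9141) — ideator 3, generation 2 (round 1)

First lemmas of two NEW crux idea cards (planner-cruxidea-stmt-AtomisticToContinuum-9141-3-g2-0),
levers not used by the seven round-1 cards already filed on this crux:

* § 0  vocabulary: the crux's quantifier prefix (`Uniq`, `IsFamily`, `IsResponseSeq`,
        `IsResponseAt`) and the crux AT ONE PARAMETER POINT `CruxAt ω₂ lam β γ T`, with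
        `boundedResponseConverges_iff_cruxAt` (PROVED, `Iff` by reordering binders).

* § A  card `stieltjes-contact-rigidity` — THE BATH COUPLING IS A STIELTJES VARIABLE.
        Fixed-`N` structure theorem (the card's First lemma, typed `StieltjesCouplingStructure`):
        for fixed `(ω₂, lam, β, T, N)` there are `a ≥ 0` and a finite Borel measure `ρ` on `[0,∞)`,
        NOT depending on `γ`, with
            `γ · D_N(γ) = a + ∫ (γ⁻² + t)⁻¹ dρ(t)`     for every Langevin coupling `γ > 0`,
        i.e. `γ ↦ γ D_N(γ)` is a Stieltjes transform evaluated at `y = γ⁻²`.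
        Paper proof (NOTES.md F1–F3): (i) Kundu–Dhar–Narayan open-chain Green–Kubo
        `(N−1)T² D_N(γ) = ⟨J_tot, (−L_γ)⁻¹ J_tot⟩_{L²(μ_T)}` with `L_γ = A + γS₁`, where the
        Liouvillian `A` (μ_T-antisymmetric), the bath operator `S₁ = Σ_b (T∂²_{p_b} − p_b∂_{p_b})`
        (μ_T-symmetric, ≤ 0), the Gibbs state `μ_T` and `J_tot` are ALL independent of `γ`
        (re-derived in NOTES.md F1 from `generator_hamiltonian`/`sum_bondCurrent_eq_poisson`:
        the first-order source is `𝒮Y/(2T²)`, `Y = Σ_k (1 − 2k/(N−1)) e_k`, `AY = −2J_tot/(N−1)`);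
        (ii) for `𝒮 := −S₁ ≥ 0`, `ε > 0`, `η = 1/γ`: the symmetric part of the resolvent of
        `𝒮 + ε − ηA` is `(𝒮 + ε + η² Aᵀ(𝒮+ε)⁻¹A)⁻¹` (operator identity
        `Sym((P−B)⁻¹) = (P + BᵀP⁻¹B)⁻¹` for `P > 0` symmetric, `B` antisymmetric), so
        `F_ε(y) := ⟨J,(𝒮 + ε + y·𝒬_ε)⁻¹J⟩`, `𝒬_ε := Aᵀ(𝒮+ε)⁻¹A ≥ 0`, is a Stieltjes function of
        `y = η²` (spectral theorem for `K = (𝒮+ε)^{-1/2} 𝒬_ε (𝒮+ε)^{-1/2} ≥ 0`: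
        `F_ε(y) = ∫ (1 + y k)⁻¹ dν(k)`), and `γ ⟨J,(γε − L_γ)⁻¹J⟩ = F_ε(γ⁻²)` by scaling;
        (iii) `ε → 0` at fixed `N` (spectral gap of the hypoelliptic chain, CEHR 2018) and closure
        of the Stieltjes class under pointwise limits give `γ (N−1)T² D_N(γ) = F₀(γ⁻²)`.
        Sanity: harmonic dimer `D₂ ∝ γk/(k+γ²)` ⇒ `γ D₂ ∝ (γ⁻² + 1/k)⁻¹` ✓.
        Consequences typed and partly PROVED here: the COUPLING ENVELOPE
        (`γ D ↑`, `D/γ ↓`, `D ≥ 0`; `CouplingEnvelope`) and the transfer of the crux's own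
        hypothesis along the coupling axis, `D_N(γ′) ≤ max(γ′/γ, γ/γ′)·D_N(γ)`
        (`coupling_transfer`, `bddAbove_transfer`, PROVED) — bounded response is `γ`-UNIFORM; hence
        `{γ ↦ γ D_N(γ)}_N` is a NORMAL FAMILY on `ℂ ∖ (−∞,0]` from the crux hypothesis at ONE
        coupling (Stieltjes transforms: `|F(z)| ≤ F(|z|)/cos(arg z/2)`), and VITALI–PORTER
        (`StieltjesSeedPropagation`, pure analysis) propagates convergence-with-positive-limit of
        `D_N(γ′)` from ANY set of couplings with an accumulation point in `(0,∞)` (`ClusterSeed`,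
        e.g. the weak-contact window `WeakContactSeed`) to EVERY `γ`: `StieltjesComposition`.

* § B  card `flip-noise-detour` — the slot closes from route VanishingNoiseTransfer's two cruxes
        `NoiseLocality` (stmt-11975) and `NoisyFourier` (stmt-11977) ALONE: the crux's hypothesis
        `BddAbove (range |D|)` replaces that route's third crux `VanishingNoiseBound` (stmt-11976),
        because `|D_N(0)| ≤ S` gives `|1/D_N(0)| ≥ 1/S`, which with the resistivity modulus
        `|1/D_N(0) − 1/D_N(ε)| ≤ w(ε) < 1/S` and `D_N(ε) > 0` forces `D_N(0) > 0` and
        `1/D_N(0) ≥ 1/S`; `1/D_N(0)` is then Cauchy (oscillation ≤ 2w(ε) + o(1)) with limit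
        `r₀ ≥ 1/S > 0`. KERNEL-CHECKED: `transfer_bdd` (pure real analysis) and
        `slot_of_noise : NoiseLocality → NoisyFourier → BoundedResponseConverges` (PROVED, concludes
        the crux decl BY NAME).
-/

noncomputable section

namespace Summit.AtomisticToContinuum.FouriersLaw.Cruxes.BoundedResponseConverges.Ideator3g2

open Filter Topology MeasureTheory
open Literature.MathematicalPhysics.KineticTheory.HeatConduction
open Summit.AtomisticToContinuum.FouriersLaw.Theses.OddSectorIrreversibility
  (BoundedResponseConverges NessUnique FiniteResponseOfUnique)
open Summit.AtomisticToContinuum.FouriersLaw.Theses.VanishingNoiseTransfer (NoiseLocality NoisyFourier)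

/-! ### § 0 Vocabulary -/

/-- weak-NESS uniqueness for `pinnedChain ω₂ lam β γ` (the crux's first hypothesis, verbatim body). -/
def Uniq (ω₂ lam β γ : ℝ) : Prop :=
  ∀ (N : ℕ) (T_L T_R : ℝ), 0 < T_L → 0 < T_R →
    ∀ μ ν : Measure (PhaseSpace N),
      (pinnedChain ω₂ lam β γ).IsSteadyState N T_L T_R μ →
      (pinnedChain ω₂ lam β γ).IsSteadyState N T_L T_R ν → μ = ν

/-- `μ` is a steady-state family of the chain with coupling `γ` (the crux's second hypothesis). -/
def IsFamily (ω₂ lam β γ : ℝ) (μ : (N : ℕ) → ℝ → ℝ → Measure (PhaseSpace N)) : Prop :=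
  ∀ (N : ℕ) (T_L T_R : ℝ), 0 < T_L → 0 < T_R →
    (pinnedChain ω₂ lam β γ).IsSteadyState N T_L T_R (μ N T_L T_R)

/-- `d` is the clause-(ii) response coefficient of the `γ`-chain at length `N` and temperature `T`
along the family `μ`. -/
def IsResponseAt (ω₂ lam β γ : ℝ) (μ : (N : ℕ) → ℝ → ℝ → Measure (PhaseSpace N)) (T : ℝ)
    (N : ℕ) (d : ℝ) : Prop :=
  Tendsto (fun δ : ℝ =>
    (pinnedChain ω₂ lam β γ).totalCurrent (μ N (T + δ / 2) (T - δ / 2)) / δ) (𝓝[≠] 0) (𝓝 d)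

/-- `D` is THE sequence of response coefficients along `μ` at `T`. -/
def IsResponseSeq (ω₂ lam β γ : ℝ) (μ : (N : ℕ) → ℝ → ℝ → Measure (PhaseSpace N)) (T : ℝ)
    (D : ℕ → ℝ) : Prop :=
  ∀ N : ℕ, IsResponseAt ω₂ lam β γ μ T N (D N)

/-- The crux's matrix AT ONE PARAMETER POINT `(ω₂, lam, β, γ, T)`. -/
def CruxAt (ω₂ lam β γ T : ℝ) : Prop :=
  Uniq ω₂ lam β γ → ∀ μ : (N : ℕ) → ℝ → ℝ → Measure (PhaseSpace N), IsFamily ω₂ lam β γ μ →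
    ∀ D : ℕ → ℝ, IsResponseSeq ω₂ lam β γ μ T D →
      BddAbove (Set.range fun N => |D N|) → ∃ k : ℝ, 0 < k ∧ Tendsto D atTop (𝓝 k)

/-- The crux is `CruxAt` at every admissible point (PROVED: binder reordering only). -/
theorem boundedResponseConverges_iff_cruxAt :
    BoundedResponseConverges ↔
      ∀ ω₂ lam β γ : ℝ, 0 < ω₂ → 0 < lam → 0 < β → 0 < γ → ∀ T : ℝ, 0 < T →
        CruxAt ω₂ lam β γ T := by
  constructor
  · intro h ω₂ lam β γ h1 h2 h3 h4 T hT hu μ hμ D hD hB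
    exact h ω₂ lam β γ h1 h2 h3 h4 hu μ hμ T hT D hD hB
  · intro h ω₂ lam β γ h1 h2 h3 h4 hu μ hμ T hT D hD hB
    exact h ω₂ lam β γ h1 h2 h3 h4 T hT hu μ hμ D hD hB

/-! ### § A Card `stieltjes-contact-rigidity` -/

/-- `g` is a STIELTJES TRANSFORM IN THE COUPLING: `g γ = a + ∫ (γ⁻² + t)⁻¹ dρ(t)` for all `γ > 0`,
with `a ≥ 0` and `ρ` a finite measure carried by `[0, ∞)` (an atom of `ρ` at `t = 0` is the
`b·γ²` term of the general Stieltjes class). -/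
def IsStieltjesInCoupling (a : ℝ) (ρ : Measure ℝ) (g : ℝ → ℝ) : Prop :=
  0 ≤ a ∧ IsFiniteMeasure ρ ∧ ρ (Set.Iio 0) = 0 ∧
    ∀ γ : ℝ, 0 < γ → g γ = a + ∫ t, (γ⁻¹ ^ 2 + t)⁻¹ ∂ρ

/-- **A1 · STIELTJES COUPLING STRUCTURE** (the card's First lemma; fixed `N`, theorem-grade functional
analysis of the hypoelliptic chain): for fixed `(ω₂, lam, β, T, N)` ONE Stieltjes transform `g_N`
represents `γ · d` for EVERY coupling `γ > 0` and every response value `d` of the `γ`-chain at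
`(N, T)` (under weak-NESS uniqueness for that chain, which pins `d`). Content: KDN open-chain
Green–Kubo + the symmetric-part-of-resolvent pencil `γ𝒮 + γ⁻¹Aᵀ𝒮⁻¹A` (header § A (i)–(iii)). -/
def StieltjesCouplingStructure : Prop :=
  ∀ ω₂ lam β T : ℝ, 0 < ω₂ → 0 < lam → 0 < β → 0 < T → ∀ N : ℕ,
    ∃ a : ℝ, ∃ ρ : Measure ℝ, ∃ g : ℝ → ℝ, IsStieltjesInCoupling a ρ g ∧
      ∀ γ : ℝ, 0 < γ → Uniq ω₂ lam β γ →
        ∀ μ : (N : ℕ) → ℝ → ℝ → Measure (PhaseSpace N), IsFamily ω₂ lam β γ μ →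
          ∀ d : ℝ, IsResponseAt ω₂ lam β γ μ T N d → γ * d = g γ

/-- The COUPLING ENVELOPE of a Stieltjes-in-coupling function: `g ↑` (i.e. `γ D ↑`),
`g γ / γ² ↓` (i.e. `D/γ ↓`), `g ≥ 0`. For Stieltjes transforms these are one-line consequences of
`(γ⁻² + t)⁻¹ ↑` and `γ⁻²(γ⁻² + t)⁻¹ ↓` in `γ` (typed `StieltjesEnvelope`, real analysis). -/
def CouplingEnvelope (g : ℝ → ℝ) : Prop :=
  (∀ γ γ' : ℝ, 0 < γ → γ ≤ γ' → g γ ≤ g γ') ∧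
  (∀ γ γ' : ℝ, 0 < γ → γ ≤ γ' → g γ' / γ' ^ 2 ≤ g γ / γ ^ 2) ∧
  (∀ γ : ℝ, 0 < γ → 0 ≤ g γ)

/-- Stieltjes-in-coupling functions have the coupling envelope (provable now: monotone integrands
against a finite positive measure). -/
def StieltjesEnvelope : Prop :=
  ∀ (a : ℝ) (ρ : Measure ℝ) (g : ℝ → ℝ), IsStieltjesInCoupling a ρ g → CouplingEnvelope g

/-- **COUPLING TRANSFER OF BOUNDED RESPONSE** (PROVED from the envelope): if `γ d = g γ` and
`γ₁ d₁ = g γ₁` then `d ≤ max (γ/γ₁) (γ₁/γ) · d₁` — bounded response at ONE Langevin coupling is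
bounded response at every coupling, with an explicit factor. -/
theorem coupling_transfer {g : ℝ → ℝ} (hg : CouplingEnvelope g) {γ γ₁ d d₁ : ℝ} (hγ : 0 < γ)
    (hγ₁ : 0 < γ₁) (hd : γ * d = g γ) (hd₁ : γ₁ * d₁ = g γ₁) :
    d ≤ max (γ / γ₁) (γ₁ / γ) * d₁ := by
  obtain ⟨hmono, hanti, hnn⟩ := hg
  have hd₁nn : 0 ≤ d₁ := by
    have : 0 ≤ γ₁ * d₁ := by rw [hd₁]; exact hnn γ₁ hγ₁
    exact nonneg_of_mul_nonneg_right (by simpa [mul_comm] using this) hγ₁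
  rcases le_total γ γ₁ with hle | hle
  · -- γ ≤ γ₁: monotonicity of g gives γ d ≤ γ₁ d₁, i.e. d ≤ (γ₁/γ) d₁
    have h1 : γ * d ≤ γ₁ * d₁ := by rw [hd, hd₁]; exact hmono γ γ₁ hγ hle
    have h2 : d ≤ γ₁ / γ * d₁ := by
      rw [div_mul_eq_mul_div, le_div_iff₀ hγ]
      linarith
    calc d ≤ γ₁ / γ * d₁ := h2
      _ ≤ max (γ / γ₁) (γ₁ / γ) * d₁ := by gcongr; exact le_max_right _ _
  · -- γ₁ ≤ γ: antitonicity of g γ / γ² gives d/γ ≤ d₁/γ₁, i.e. d ≤ (γ/γ₁) d₁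
    have h1 : g γ / γ ^ 2 ≤ g γ₁ / γ₁ ^ 2 := hanti γ₁ γ hγ₁ hle
    rw [← hd, ← hd₁] at h1
    have e1 : γ * d / γ ^ 2 = d / γ := by field_simp
    have e2 : γ₁ * d₁ / γ₁ ^ 2 = d₁ / γ₁ := by field_simp
    rw [e1, e2, div_le_div_iff₀ hγ hγ₁] at h1
    have h2 : d ≤ γ / γ₁ * d₁ := by
      rw [div_mul_eq_mul_div, le_div_iff₀ hγ₁]
      linarith
    calc d ≤ γ / γ₁ * d₁ := h2
      _ ≤ max (γ / γ₁) (γ₁ / γ) * d₁ := by gcongr; exact le_max_left _ _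

/-- **γ-UNIFORMITY OF THE CRUX'S HYPOTHESIS** (PROVED, sequence level): along two response sequences
represented by the SAME Stieltjes family `g N`, `BddAbove` transfers from coupling `γ₁` to `γ`. -/
theorem bddAbove_transfer {g : ℕ → ℝ → ℝ} (hg : ∀ N, CouplingEnvelope (g N)) {γ γ₁ : ℝ}
    (hγ : 0 < γ) (hγ₁ : 0 < γ₁) {D D₁ : ℕ → ℝ} (hD : ∀ N, γ * D N = g N γ)
    (hD₁ : ∀ N, γ₁ * D₁ N = g N γ₁) (hB : BddAbove (Set.range fun N => |D₁ N|)) :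
    BddAbove (Set.range fun N => |D N|) := by
  obtain ⟨B, hB⟩ := hB
  refine ⟨max (γ / γ₁) (γ₁ / γ) * B, ?_⟩
  rintro _ ⟨N, rfl⟩
  have hDnn : 0 ≤ D N := by
    have : 0 ≤ γ * D N := by rw [hD N]; exact (hg N).2.2 γ hγ
    exact nonneg_of_mul_nonneg_right (by simpa [mul_comm] using this) hγ
  have h1 : D N ≤ max (γ / γ₁) (γ₁ / γ) * D₁ N := coupling_transfer (hg N) hγ hγ₁ (hD N) (hD₁ N)
  have h2 : D₁ N ≤ B := le_trans (le_abs_self _) (hB ⟨N, rfl⟩)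
  have hM : 0 ≤ max (γ / γ₁) (γ₁ / γ) := le_trans (by positivity) (le_max_left _ _)
  calc |D N| = D N := abs_of_nonneg hDnn
    _ ≤ max (γ / γ₁) (γ₁ / γ) * D₁ N := h1
    _ ≤ max (γ / γ₁) (γ₁ / γ) * B := by gcongr

/-- **A2 · VITALI–PORTER FOR STIELTJES TRANSFORMS** (pure analysis stub; Literature-grade): a sequence
of Stieltjes-in-coupling functions bounded at ONE coupling is a normal family on `ℂ ∖ (−∞,0]`
(`|g(z)| ≤ g(|z|)/cos(arg z/2)` after `y = γ⁻²`), so convergence to positive limits on a set of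
couplings with an accumulation point in `(0,∞)` propagates to EVERY coupling, the limit being again
Stieltjes-in-coupling, hence `> 0` everywhere once `> 0` somewhere. -/
def StieltjesSeedPropagation : Prop :=
  ∀ (a : ℕ → ℝ) (ρ : ℕ → Measure ℝ) (g : ℕ → ℝ → ℝ),
    (∀ n, IsStieltjesInCoupling (a n) (ρ n) (g n)) →
    (∃ γ₁ : ℝ, 0 < γ₁ ∧ BddAbove (Set.range fun n => g n γ₁)) →
    (∃ E : Set ℝ, E ⊆ Set.Ioi 0 ∧ (∃ γ₀ : ℝ, 0 < γ₀ ∧ AccPt γ₀ (𝓟 E)) ∧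
        ∀ γ ∈ E, ∃ ℓ : ℝ, 0 < ℓ ∧ Tendsto (fun n => g n γ) atTop (𝓝 ℓ)) →
    ∀ γ : ℝ, 0 < γ → ∃ ℓ : ℝ, 0 < ℓ ∧ Tendsto (fun n => g n γ) atTop (𝓝 ℓ)

/-- **A3 · CLUSTER SEED**: for every `(ω₂, lam, β, T)` the crux holds on SOME set of Langevin
couplings accumulating at a positive coupling — to be supplied by whichever line finds ONE window of
contacts where it can prove the limit (the weak-contact window below, or any other). -/
def ClusterSeed : Prop :=
  ∀ ω₂ lam β T : ℝ, 0 < ω₂ → 0 < lam → 0 < β → 0 < T →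
    ∃ E : Set ℝ, E ⊆ Set.Ioi 0 ∧ (∃ γ₀ : ℝ, 0 < γ₀ ∧ AccPt γ₀ (𝓟 E)) ∧
      ∀ γ ∈ E, CruxAt ω₂ lam β γ T

/-- **A3′ · WEAK-CONTACT SEED** (the suggested instance of `ClusterSeed`): the crux in a window of
small couplings `γ < γ₀(ω₂, lam, β, T)`, where the apparent contact resistance read off consecutive
lengths is dominated by the explicit bath jumps `2/γ` (ledger `R_N = 2/γ + Σ r_{i,N}`), so the
length-monotone sign `D_N ≤ D_{N+1}` of cards length-monotone-kirchhoff-mean /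
ohmic-floor-monotone-ladder has room `2/γ → ∞` against internal layer rearrangements. -/
def WeakContactSeed : Prop :=
  ∀ ω₂ lam β T : ℝ, 0 < ω₂ → 0 < lam → 0 < β → 0 < T →
    ∃ γ₀ : ℝ, 0 < γ₀ ∧ ∀ γ : ℝ, 0 < γ → γ < γ₀ → CruxAt ω₂ lam β γ T

/-- Shape of the line (composition claim, for crux-plan): structure + envelope + Vitali + a cluster
seed + the shared frame (uniqueness and existence of responses at the OTHER couplings, items 0741 /
0717, stated for all parameters) ⇒ the crux at the conjunct's coupling. The crux's own `BddAbove`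
enters twice: through `bddAbove_transfer` it feeds the seed's hypothesis at the other couplings, and
it is the normal-family bound of A2. -/
def StieltjesComposition : Prop :=
  StieltjesCouplingStructure → StieltjesEnvelope → StieltjesSeedPropagation → ClusterSeed →
    NessUnique → FiniteResponseOfUnique → BoundedResponseConverges

/-! ### § B Card `flip-noise-detour` -/

/-- **VANISHING-NOISE TRANSFER UNDER BOUNDED RESPONSE** (PROVED, pure real analysis): if `|D⁰_N| ≤ S`,
`w → 0` at `0⁺`, and for every `ε ∈ (0,1]` some sequence `D^ε_N → k_ε > 0` satisfies
`|D⁰_N − D^ε_N| ≤ w(ε)|D⁰_N||D^ε_N|` for all `N`, then `D⁰_N → L ∈ (0, ∞)`. Compared with route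
VanishingNoiseTransfer's `transfer` the bound `k_ε ≤ K` (crux `VanishingNoiseBound`) is NOT needed:
`|1/D⁰_N| ≥ 1/S` does its job. -/
theorem transfer_bdd (D0 : ℕ → ℝ) (S : ℝ) (hS : 0 < S) (hbd : ∀ N, |D0 N| ≤ S) (w : ℝ → ℝ)
    (hw : Tendsto w (𝓝[>] 0) (𝓝 0))
    (h : ∀ ε : ℝ, 0 < ε → ε ≤ 1 → ∃ kε : ℝ, ∃ Dε : ℕ → ℝ, 0 < kε ∧
        Tendsto Dε atTop (𝓝 kε) ∧ ∀ N, |D0 N - Dε N| ≤ w ε * |D0 N| * |Dε N|) :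
    ∃ L : ℝ, 0 < L ∧ Tendsto D0 atTop (𝓝 L) := by
  -- for admissible ε with |w ε| < 1/S: eventually |1/D⁰_N − 1/k_ε| < |w ε| + η AND 1/S ≤ 1/D⁰_N
  have key : ∀ ε : ℝ, 0 < ε → ε ≤ 1 → |w ε| < S⁻¹ → ∃ kε : ℝ, 0 < kε ∧
      ∀ η : ℝ, 0 < η → ∀ᶠ N in atTop, |(D0 N)⁻¹ - kε⁻¹| < |w ε| + η ∧ S⁻¹ ≤ (D0 N)⁻¹ := by
    intro ε hε hε1 hwS
    obtain ⟨kε, Dε, hk, hconv, hloc⟩ := h ε hε hε1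
    refine ⟨kε, hk, fun η hη => ?_⟩
    have hinv : Tendsto (fun N => (Dε N)⁻¹) atTop (𝓝 kε⁻¹) := hconv.inv₀ hk.ne'
    have h1 : ∀ᶠ N in atTop, kε / 2 < Dε N := hconv.eventually_const_lt (by linarith)
    have h2 : ∀ᶠ N in atTop, |(Dε N)⁻¹ - kε⁻¹| < η := by
      have := (Metric.tendsto_nhds.mp hinv) η hη
      simpa only [Real.dist_eq] using this
    filter_upwards [h1, h2] with N hN1 hN2
    have hDpos : 0 < Dε N := by linarith
    have hloc' := hloc N
    have hD0 : D0 N ≠ 0 := by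
      intro h0
      rw [h0] at hloc'
      simp only [zero_sub, abs_neg, abs_zero, mul_zero, zero_mul] at hloc'
      exact absurd (abs_nonpos_iff.mp hloc') hDpos.ne'
    have h3 : |(D0 N)⁻¹ - (Dε N)⁻¹| ≤ |w ε| := by
      have hprod : 0 < |D0 N| * |Dε N| := mul_pos (abs_pos.mpr hD0) (abs_pos.mpr hDpos.ne')
      have heq : (D0 N)⁻¹ - (Dε N)⁻¹ = (Dε N - D0 N) / (D0 N * Dε N) := by
        field_simp
      rw [heq, abs_div, abs_mul, div_le_iff₀ hprod]
      calc |Dε N - D0 N| = |D0 N - Dε N| := abs_sub_comm _ _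
        _ ≤ w ε * |D0 N| * |Dε N| := hloc'
        _ ≤ |w ε| * |D0 N| * |Dε N| := by gcongr; exact le_abs_self _
        _ = |w ε| * (|D0 N| * |Dε N|) := by ring
    have habsinv : S⁻¹ ≤ |(D0 N)⁻¹| := by
      rw [abs_inv]
      exact inv_anti₀ (abs_pos.mpr hD0) (hbd N)
    have hposinv : 0 < (D0 N)⁻¹ := by
      by_contra hle
      push Not at hle
      have hDεinv : 0 < (Dε N)⁻¹ := inv_pos.mpr hDpos
      have h4 : |(D0 N)⁻¹| = -(D0 N)⁻¹ := abs_of_nonpos hle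
      have h5 : |(D0 N)⁻¹ - (Dε N)⁻¹| = (Dε N)⁻¹ - (D0 N)⁻¹ := by
        rw [abs_sub_comm]
        exact abs_of_pos (by linarith)
      have : S⁻¹ < S⁻¹ :=
        calc S⁻¹ ≤ |(D0 N)⁻¹| := habsinv
          _ = -(D0 N)⁻¹ := h4
          _ < (Dε N)⁻¹ - (D0 N)⁻¹ := by linarith
          _ = |(D0 N)⁻¹ - (Dε N)⁻¹| := h5.symm
          _ ≤ |w ε| := h3
          _ < S⁻¹ := hwS
      exact lt_irrefl _ this
    refine ⟨?_, ?_⟩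
    · calc |(D0 N)⁻¹ - kε⁻¹| ≤ |(D0 N)⁻¹ - (Dε N)⁻¹| + |(Dε N)⁻¹ - kε⁻¹| := abs_sub_le _ _ _
        _ < |w ε| + η := by linarith
    · calc S⁻¹ ≤ |(D0 N)⁻¹| := habsinv
        _ = (D0 N)⁻¹ := abs_of_pos hposinv
  -- admissible ε with small modulus exist
  have hsmall : ∀ η : ℝ, 0 < η → ∃ ε : ℝ, 0 < ε ∧ ε ≤ 1 ∧ |w ε| < η ∧ |w ε| < S⁻¹ := by
    intro η hη
    have hη' : 0 < min η S⁻¹ := lt_min hη (inv_pos.mpr hS)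
    have h1 : ∀ᶠ ε in 𝓝[>] (0 : ℝ), |w ε| < min η S⁻¹ := by
      have := (Metric.tendsto_nhds.mp hw) (min η S⁻¹) hη'
      simpa only [Real.dist_eq, sub_zero] using this
    have h2 : ∀ᶠ ε in 𝓝[>] (0 : ℝ), ε ≤ 1 :=
      mem_nhdsWithin_of_mem_nhds (Iic_mem_nhds one_pos)
    have h3 : ∀ᶠ ε in 𝓝[>] (0 : ℝ), 0 < ε := self_mem_nhdsWithin
    obtain ⟨ε, hε, hε1, hε2⟩ := (h3.and (h2.and h1)).exists
    exact ⟨ε, hε, hε1, lt_of_lt_of_le hε2 (min_le_left _ _), lt_of_lt_of_le hε2 (min_le_right _ _)⟩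
  -- the resistivities r N = (D0 N)⁻¹ form a Cauchy sequence
  have hcauchy : CauchySeq (fun N => (D0 N)⁻¹) := by
    refine Metric.cauchySeq_iff.2 fun η hη => ?_
    obtain ⟨ε, hε, hε', hwε, hwS⟩ := hsmall (η / 4) (by positivity)
    obtain ⟨kε, hk, hev⟩ := key ε hε hε' hwS
    obtain ⟨N₀, hN₀⟩ := (hev (η / 4) (by positivity)).exists_forall_of_atTop
    refine ⟨N₀, fun m hm n hn => ?_⟩
    have hm' := (hN₀ m hm).1
    have hn' := (hN₀ n hn).1
    rw [Real.dist_eq]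
    calc |(D0 m)⁻¹ - (D0 n)⁻¹| ≤ |(D0 m)⁻¹ - kε⁻¹| + |kε⁻¹ - (D0 n)⁻¹| := abs_sub_le _ _ _
      _ = |(D0 m)⁻¹ - kε⁻¹| + |(D0 n)⁻¹ - kε⁻¹| := by rw [abs_sub_comm kε⁻¹ (D0 n)⁻¹]
      _ < η := by linarith
  obtain ⟨r₀, hr₀⟩ := cauchySeq_tendsto_of_complete hcauchy
  -- its limit r₀ is at least 1/S > 0 (this is where the crux's boundedness replaces `k_ε ≤ K`)
  have hlow : S⁻¹ ≤ r₀ := by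
    obtain ⟨ε, hε, hε', -, hwS⟩ := hsmall 1 one_pos
    obtain ⟨kε, hk, hev⟩ := key ε hε hε' hwS
    have hevr : ∀ᶠ N in atTop, S⁻¹ ≤ (D0 N)⁻¹ := by
      filter_upwards [hev 1 one_pos] with N hN using hN.2
    exact ge_of_tendsto hr₀ hevr
  have hr₀pos : 0 < r₀ := lt_of_lt_of_le (inv_pos.mpr hS) hlow
  refine ⟨r₀⁻¹, inv_pos.mpr hr₀pos, ?_⟩
  have hD : D0 = fun N => ((D0 N)⁻¹)⁻¹ := by
    funext N
    simp
  rw [hD]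
  exact hr₀.inv₀ hr₀pos.ne'

/-- **THE SLOT CLOSES FROM VANISHINGNOISETRANSFER'S TWO CRUXES** (PROVED, concludes the crux decl by
name): `NoiseLocality` (stmt-11975: N-uniform modulus of the flip-noise resistivity) and
`NoisyFourier` (stmt-11977: Fourier's law for the flip-noisy chain at every noise rate) imply
`BoundedResponseConverges`; the crux's `BddAbove` hypothesis discharges the third crux
`VanishingNoiseBound` (stmt-11976) of that route. -/
theorem slot_of_noise (hNL : NoiseLocality) (hNF : NoisyFourier) : BoundedResponseConverges := by
  -- a family of measures chosen at positive temperatures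
  have famChoice : ∀ {Q : (N : ℕ) → ℝ → ℝ → Measure (PhaseSpace N) → Prop},
      (∀ (N : ℕ) (T_L T_R : ℝ), 0 < T_L → 0 < T_R → ∃ μ, Q N T_L T_R μ) →
      ∃ fam : (N : ℕ) → ℝ → ℝ → Measure (PhaseSpace N),
        ∀ (N : ℕ) (T_L T_R : ℝ), 0 < T_L → 0 < T_R → Q N T_L T_R (fam N T_L T_R) := by
    intro Q hQ
    classical
    refine ⟨fun N T_L T_R => if h : 0 < T_L ∧ 0 < T_R then (hQ N T_L T_R h.1 h.2).choose else 0,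
      fun N T_L T_R hL hR => ?_⟩
    simp only [dif_pos (And.intro hL hR)]
    exact (hQ N T_L T_R hL hR).choose_spec
  intro ω₂ lam β γ hω hl hβ hγ huniq μ hμ T hT D hD hB
  obtain ⟨B, hB'⟩ := hB
  have hS : 0 < max B 1 := lt_of_lt_of_le one_pos (le_max_right _ _)
  have hbd : ∀ N, |D N| ≤ max B 1 := fun N => (hB' ⟨N, rfl⟩).trans (le_max_left _ _)
  obtain ⟨w, hw, hloc⟩ := hNL ω₂ lam β γ hω hl hβ hγ _ rfl T hT
  refine transfer_bdd D (max B 1) hS hbd w hw fun ε hε hε1 => ?_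
  obtain ⟨hexu, κε, hκεpos, hresp⟩ := hNF ω₂ lam β γ hω hl hβ hγ _ rfl ε hε
  -- the unique noisy steady-state family at rate ε (NoisyFourier clause (i))
  obtain ⟨με, hμε⟩ := famChoice hexu
  -- its responses and their limit κ_ε(T) > 0 (NoisyFourier clause (ii))
  obtain ⟨Dε, hDε, hDεlim⟩ := hresp με (fun N T_L T_R hL hR => (hμε N T_L T_R hL hR).1) T hT
  refine ⟨κε T, Dε, hκεpos T hT, hDεlim, fun N => ?_⟩
  -- |D_N(0) − D_N(ε)| ≤ w ε |D_N(0)| |D_N(ε)| (NoiseLocality at length N)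
  exact hloc N ε hε hε1 (μ N) (με N)
    (fun T_L T_R hL hR => ⟨hμ N T_L T_R hL hR,
      fun ν hν => huniq N T_L T_R hL hR ν _ hν (hμ N T_L T_R hL hR)⟩)
    (fun T_L T_R hL hR => hμε N T_L T_R hL hR) _ _ (hD N) (hDε N)

end Summit.AtomisticToContinuum.FouriersLaw.Cruxes.BoundedResponseConverges.Ideator3g2

end
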